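import Mathlib.MeasureTheory.Integral.IntervalIntegral.Basic
import Mathlib.MeasureTheory.Function.StronglyMeasurable.AEStronglyMeasurable
import Mathlib.MeasureTheory.Measure.Prod
import Literature.Analysis.FunctionSpaces.Complexify
import Literature.Analysis.FunctionSpaces.FlatTorus
import Literature.Analysis.FunctionSpaces.TorusCalculus
import Literature.Analysis.FunctionSpaces.TorusTestFunction
import Literature.Analysis.FunctionSpaces.TorusSobolevNorm
import HarnessLib

-- provenance: harness21/H21/H21/Prelude/Sobolev/TorusFluidGlue.lean @ c144f38 (interim HEAD d8f2665); M5 mechanical rewrite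
/-!
# Fluid glue on the flat torus: classical / weak Navier–Stokes and Euler, energy functionals
(trunk: Sobolev, concept C12 `TorusFluidGlue`; off-trunk glue hosting the T-FLUID S-notions
`ns_classical_solution`, `weak_euler_solution`, `energy_dissipation_functionals` restricted to
`T^d`, outline `H21/Outlines/Sobolev.md` §C12 and contract §4.6)

All fields are real, time first: `u : ℝ → UnitAddTorus d → EuclideanSpace ℝ d`, in the context
`{d} [Fintype d] [DecidableEq d]`, on the torus decision of `FlatTorus` (global `volume`, a
probability measure).

## Contents (this file owns exactly these fluid notions; T-FLUID extends, does not fork)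

* `Torus.IsClassicalNSSolutionOn S ν f u p`: smooth solutions of the forced incompressible
  Navier–Stokes system on `T^d × S` (Fefferman's periodic problem (B); Euler is `ν = 0`), with the
  **one-sided** time derivative `Torus.timeDerivWithin S` (`derivWithin _ S t`), the convention of
  the accepted `Literature.Analysis.FluidPDE.IsNavierStokesSolution` (a two-sided `deriv` would see the unconstrained
  values of `u` outside `S` at endpoints). Initial data are *not* part of the structure: statements
  add `u 0 = u₀`.
* `Torus.IsWeakNSSolutionOn T ν u`: distributional (pressure-free) solutions on `T^d × (0,T)`
  tested against smooth divergence-free fields compactly supported in `(0,T)`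
  (De Lellis–Székelyhidi 2009, §1; Buckmaster–Vicol 2019, Def. 1.1). **Mean zero:** BV Def. 1.1
  additionally normalises `∫ u(t) = 0`; this predicate deliberately omits it (DLS convention,
  Galilean invariance); statements needing it add `∀ t, Torus.HasZeroMean (u t)`.
* `Torus.IsWeakNSSolutionWithDataOn T ν u₀ u`: the same with test fields on `[0,T)` and the
  initial-datum term `∫ ⟪u₀, ψ 0⟫` (Temam, Ch. III §1.1, (1.22)–(1.23));
  `Torus.IsWeakEulerSolutionOn T u := IsWeakNSSolutionOn T 0 u`.
* Functionals: `Torus.kineticEnergy v = ½ ∫ ‖v‖²`, `Torus.gradNormSq v = ∫ ∑ᵢ ‖∂ᵢ v‖²` —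
  **character-for-character** the accepted `Literature.Analysis.FluidPDE.TurbWave0.kineticEnergy` / `Literature.Analysis.FluidPDE.TurbWave0.gradNormSq`
  (Statements/Turb/Wave0; the bridges are `rfl`, outline §0, and the supervisor re-bases Wave0 on
  these), the spectral variant `Torus.eGradNormSq` for non-smooth fields, and
  `Torus.cumulativeDissipation ν u a b = ν ∫ₐᵇ ‖∇u(t)‖²₂ dt`.
* Sanity lemmas (proofs `sorry`): classical ⇒ weak, the energy balance, nonnegativity, and the
  identification of `gradNormSq` with `eGradNormSq` on smooth fields.

Long-time averages (`Turb.timeMean`, `Turb.longTimeAvgSup`) are **not** defined here (owned by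
T-FLUID in Statements/Turb/Wave0).

## Mathlib

Mathlib has no Navier–Stokes/Euler notions and no calculus on `AddCircle`/`UnitAddTorus`
(searched: `NavierStokes`, `Euler` fluid, `kineticEnergy`, `enstrophy` — none); all differential
operators are the `Torus.*` wrappers of `TorusCalculus` around Mathlib's `fderiv`, `derivWithin`,
`gradient`, `InnerProductSpace.laplacian`. Measurability/integrability are Mathlib's
`AEStronglyMeasurable`, `lintegral`, Bochner `integral`, `intervalIntegral`.

## References

* C. Fefferman, *Existence and smoothness of the Navier–Stokes equation* (Clay, 2000/2006),
  eqs. (1)–(3), (8)–(11), problem (B).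
* C. De Lellis, L. Székelyhidi Jr., *The Euler equations as a differential inclusion*, Ann. of
  Math. 170 (2009), §1 (weak solutions of Euler).
* T. Buckmaster, V. Vicol, *Nonuniqueness of weak solutions to the Navier–Stokes equation*, Ann.
  of Math. 189 (2019), Def. 1.1, Thm. 1.2.
* R. Temam, *Navier–Stokes Equations* (3rd ed., 1984), Ch. III §1.1 (weak formulation with
  initial data).
* C. Doering, C. Foias, *Energy dissipation in body-forced turbulence*, JFM 467 (2002), §2
  (energy, dissipation).
-/

open MeasureTheory Set Topology
open scoped InnerProductSpace ENNReal

namespace Literature.Analysis.FunctionSpaces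

noncomputable section

namespace Torus

variable {d : Type*} [Fintype d] [DecidableEq d]

/-! ## Energy and dissipation functionals -/

section Functionals

omit [DecidableEq d] in
/-- The kinetic energy `E(v) = ½ ∫_{T^d} ‖v(x)‖² dx` of a velocity field on the unit torus
(Doering–Foias 2002, §2; Fefferman, eq. (7)/(11)). Character-for-character the accepted
`Literature.Analysis.FluidPDE.TurbWave0.kineticEnergy` (Statements/Turb/Wave0), which is `rfl`-equal to this and is to be
re-based on it. Junk: `0`-valued Bochner integral if `‖v‖²` is not integrable. [cite: DoeringFoias2002, §2] -/
def kineticEnergy (v : UnitAddTorus d → EuclideanSpace ℝ d) : ℝ :=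
  2⁻¹ * ∫ x, ‖v x‖ ^ 2

/-- The squared `L²` norm of the velocity gradient, `‖∇v‖₂² = ∫_{T^d} ∑ᵢ ‖∂ᵢ v(x)‖² dx`
(Frobenius norm; twice the enstrophy for divergence-free `v`) (Doering–Foias 2002, §2).
Character-for-character the accepted `Literature.Analysis.FluidPDE.TurbWave0.gradNormSq` (Statements/Turb/Wave0;
`Turb.torusPartialDeriv u i x = Torus.partialDeriv i u x` by `rfl`), to be re-based on it.
Meaningful for `C¹` fields; for rough fields use the spectral `Torus.eGradNormSq`. [cite: DoeringFoias2002, §2] -/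
def gradNormSq (v : UnitAddTorus d → EuclideanSpace ℝ d) : ℝ :=
  ∫ x, ∑ i, ‖partialDeriv i v x‖ ^ 2

omit [DecidableEq d] in
/-- The spectral squared gradient norm `‖∇v‖₂² = 4π² ∑_{k ≠ 0} |k|² ‖v̂(k)‖² ∈ [0, ∞]` of a
(possibly non-smooth) real vector field, via the homogeneous `Ḣ¹` seminorm of the complexified
field (`Torus.eHomSobolevSeminorm`, characters `e^{2πi k·x}`, whence the factor `4π²`;
Grafakos, Prop. 3.2.6 (8); Doering–Foias 2002, §2). Agrees with `gradNormSq` on smooth fields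
(`gradNormSq_eq_toReal_eGradNormSq`). **Junk note (C4):** Fourier coefficients are Bochner
integrals, hence `0` for non-integrable `v`, so `eGradNormSq v = 0` then; meaningful only for
integrable `v`. [cite: DoeringFoias2002, §2] -/
def eGradNormSq (v : UnitAddTorus d → EuclideanSpace ℝ d) : ℝ≥0∞ :=
  ENNReal.ofReal (4 * Real.pi ^ 2) * eHomSobolevSeminorm 1 (EuclideanSpace.complexify ∘ v) ^ 2

/-- The cumulative viscous energy dissipation `ν ∫ₐᵇ ‖∇u(t)‖₂² dt` of a time-dependent field over
the time interval `[a, b]` (interval integral; Doering–Foias 2002, §2, `ε = ν⟨‖∇u‖²⟩`;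
Fefferman, energy identity). Junk value `0` of the interval integral if `t ↦ gradNormSq (u t)` is
not interval integrable. [cite: DoeringFoias2002, §2   ε = ν⟨‖∇u‖²⟩] -/
def cumulativeDissipation (ν : ℝ) (u : ℝ → UnitAddTorus d → EuclideanSpace ℝ d) (a b : ℝ) : ℝ :=
  ν * ∫ t in a..b, gradNormSq (u t)

omit [DecidableEq d] in
/-- Kinetic energy is nonnegative. [folklore] -/
theorem kineticEnergy_nonneg (v : UnitAddTorus d → EuclideanSpace ℝ d) : 0 ≤ kineticEnergy v :=
  mul_nonneg (by norm_num) (integral_nonneg fun _ => sq_nonneg _)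

/-- `‖∇v‖₂² ≥ 0`. [folklore] -/
theorem gradNormSq_nonneg (v : UnitAddTorus d → EuclideanSpace ℝ d) : 0 ≤ gradNormSq v :=
  integral_nonneg fun _ => Finset.sum_nonneg fun _ _ => sq_nonneg _

/-- For smooth `v`, the derivative-based and the spectral squared gradient norms agree:
`∫ ∑ᵢ ‖∂ᵢ v‖² = 4π² ∑_{k} |k|² ‖v̂(k)‖²` (Parseval and `𝓕(∂ᵢ v)(k) = 2πi kᵢ v̂(k)`;
Grafakos, Prop. 3.2.6 (8) and §3.3; cf. `Torus.eSobolevNorm_one_sq_eq`). DISCHARGED in the tree by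
`gradNormSq_eq_toReal_eGradNormSq_holds` (`FunctionSpaces/TorusFourierCalculus.lean`).
[cite: Grafakos2014, Prop. 3.2.6 (8) with Prop. 3.2.7 (3)] -/
def gradNormSq_eq_toReal_eGradNormSq : Prop :=
  ∀ {v : UnitAddTorus d → EuclideanSpace ℝ d} (hv : IsSmooth v),
    gradNormSq v = (eGradNormSq v).toReal

end Functionals

/-! ## Classical solutions of Navier–Stokes / Euler on `T^d × S` -/

section Classical

/-- Classical (smooth) solutions of the forced incompressible Navier–Stokes system with viscosity
`ν` on `T^d × S`, `S ⊆ ℝ` a time set (typically `Ici 0` or `Icc 0 T`):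
`∂ₜu + (u·∇)u = νΔu − ∇p + f`, `div u = 0`, with `u`, `p` jointly `C^∞` on `S × T^d`
(Fefferman, eqs. (1)–(2), (8)–(11), problem (B); Euler is the case `ν = 0`). The time derivative
is the **one-sided** `Torus.timeDerivWithin S` (`derivWithin _ S t`), the convention of the
accepted `Literature.Analysis.FluidPDE.IsNavierStokesSolution`. Initial data are a separate hypothesis `u 0 = u₀` in
statements. [folklore] -/
structure IsClassicalNSSolutionOn (S : Set ℝ) (ν : ℝ)
    (f u : ℝ → UnitAddTorus d → EuclideanSpace ℝ d) (p : ℝ → UnitAddTorus d → ℝ) : Prop where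
  /-- The velocity is jointly smooth on `S × T^d`. -/
  smooth_velocity : IsSmoothSpaceTimeOn S u
  /-- The pressure is jointly smooth on `S × T^d`. -/
  smooth_pressure : IsSmoothSpaceTimeOn S p
  /-- The momentum equation `∂ₜu + (u·∇)u = νΔu − ∇p + f` holds pointwise on `S × T^d`. -/
  momentum : ∀ t ∈ S, ∀ x,
    timeDerivWithin S u t x + convect (u t) (u t) x =
      ν • laplacian (u t) x - gradient (p t) x + f t x
  /-- Incompressibility `div u(t) = 0` for `t ∈ S`. -/
  divFree : ∀ t ∈ S, IsDivFree (u t)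

end Classical

/-! ## Weak (distributional) solutions on `T^d × (0, T)` -/

section Weak

/-- Weak (distributional, pressure-free) solutions of Navier–Stokes with viscosity `ν` on
`T^d × (0,T)` (De Lellis–Székelyhidi 2009, §1; Buckmaster–Vicol 2019, Def. 1.1): `u` is
(a.e. strongly) measurable on `(0,T) × T^d`, `u ∈ L²_{t,x}`, `u(t)` is weakly divergence free
for a.e. `t ∈ (0,T)`, and for every smooth divergence-free test field `ψ` compactly supported in
time in `(0,T)`,
`∫₀ᵀ ∫ (⟪u, ∂ₜψ⟫ + ⟪u, (u·∇)ψ⟫ + ν ⟪u, Δψ⟫) dx dt = 0`.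
Test fields live on all of `ℝ` in time, so their time derivative is the two-sided
`Torus.timeDeriv`. **Mean zero:** Buckmaster–Vicol additionally require `∫ u(t) = 0`; this
predicate deliberately does *not* (De Lellis–Székelyhidi convention; Galilean invariance) —
statements that need it add `∀ t, Torus.HasZeroMean (u t)`. [cite: LellisSzekelyhidi2009, §1] -/
def IsWeakNSSolutionOn (T : ℝ) (ν : ℝ) (u : ℝ → UnitAddTorus d → EuclideanSpace ℝ d) : Prop :=
  AEStronglyMeasurable (stLift u) (volume.restrict (Ioo 0 T ×ˢ univ)) ∧
    (∫⁻ t in Ioo 0 T, ∫⁻ x, ‖u t x‖ₑ ^ 2 < ∞) ∧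
    (∀ᵐ t ∂(volume.restrict (Ioo 0 T)), IsWeaklyDivFree (u t)) ∧
    ∀ ψ : ℝ → UnitAddTorus d → EuclideanSpace ℝ d, IsSpaceTimeTestIoo T ψ → IsDivFreeTest ψ →
      ∫ t in Ioo 0 T, ∫ x, (⟪u t x, timeDeriv ψ t x⟫_ℝ + ⟪u t x, convect (u t) (ψ t) x⟫_ℝ +
        ν * ⟪u t x, laplacian (ψ t) x⟫_ℝ) = 0

/-- Weak solutions of Navier–Stokes on `T^d × [0,T)` with initial datum `u₀`, in the sense of
distributions with test fields on `[0,T)` (smooth, divergence free, vanishing near `T`, possibly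
nonzero at `t = 0`): the weak identity of `IsWeakNSSolutionOn` acquires the boundary term
`+ ∫ ⟪u₀, ψ(0)⟫` (Temam, Ch. III §1.1, (1.22)–(1.23); Buckmaster–Vicol 2019, Def. 1.1 with
Thm. 1.2's data). Mean zero is again *not* imposed. [cite: BuckmasterVicol2019, Def. 1.1 with Thm. 1.2's data] -/
def IsWeakNSSolutionWithDataOn (T : ℝ) (ν : ℝ) (u₀ : UnitAddTorus d → EuclideanSpace ℝ d)
    (u : ℝ → UnitAddTorus d → EuclideanSpace ℝ d) : Prop :=
  AEStronglyMeasurable (stLift u) (volume.restrict (Ioo 0 T ×ˢ univ)) ∧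
    (∫⁻ t in Ioo 0 T, ∫⁻ x, ‖u t x‖ₑ ^ 2 < ∞) ∧
    (∀ᵐ t ∂(volume.restrict (Ioo 0 T)), IsWeaklyDivFree (u t)) ∧
    ∀ ψ : ℝ → UnitAddTorus d → EuclideanSpace ℝ d, IsSpaceTimeTest T ψ → IsDivFreeTest ψ →
      (∫ t in Ioo 0 T, ∫ x, (⟪u t x, timeDeriv ψ t x⟫_ℝ + ⟪u t x, convect (u t) (ψ t) x⟫_ℝ +
        ν * ⟪u t x, laplacian (ψ t) x⟫_ℝ)) + ∫ x, ⟪u₀ x, ψ 0 x⟫_ℝ = 0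

/-- Weak (distributional) solutions of the incompressible Euler equations on `T^d × (0,T)`:
`IsWeakNSSolutionOn` with `ν = 0` (De Lellis–Székelyhidi 2009, §1). [cite: LellisSzekelyhidi2009, §1] -/
def IsWeakEulerSolutionOn (T : ℝ) (u : ℝ → UnitAddTorus d → EuclideanSpace ℝ d) : Prop :=
  IsWeakNSSolutionOn T 0 u

/-- A weak solution with initial datum is in particular a weak solution on the open interval
(test fields supported in `(0,T)` vanish at `t = 0`, `IsSpaceTimeTestIoo.apply_zero`). [folklore] -/
theorem IsWeakNSSolutionWithDataOn.isWeakNSSolutionOn {T ν : ℝ}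
    {u₀ : UnitAddTorus d → EuclideanSpace ℝ d} {u : ℝ → UnitAddTorus d → EuclideanSpace ℝ d}
    (h : IsWeakNSSolutionWithDataOn T ν u₀ u) : IsWeakNSSolutionOn T ν u := by
  refine ⟨h.1, h.2.1, h.2.2.1, fun ψ hψ hdiv => ?_⟩
  have := h.2.2.2 ψ hψ.isSpaceTimeTest hdiv
  simpa [hψ.apply_zero] using this

/-- Classical solutions on a time set `S ⊇ [0, T]`, unforced on `[0, T]`, are weak solutions on
`(0, T)` (multiply the momentum equation by a test field, integrate by parts in `x` on the torus
and in `t`; the pressure drops out against divergence-free tests; De Lellis–Székelyhidi 2009, §1;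
Buckmaster–Vicol 2019, §1.1). The weak notion is the unforced one, whence the hypothesis
`f = 0` on `[0, T]`. [cite: LellisSzekelyhidi2009, §1] -/
def IsClassicalNSSolutionOn.isWeakNSSolutionOn : Prop :=
  ∀ {S : Set ℝ} {ν T : ℝ} {f u : ℝ → UnitAddTorus d → EuclideanSpace ℝ d} {p : ℝ → UnitAddTorus d → ℝ} (h : IsClassicalNSSolutionOn S ν f u p) (hf : ∀ t ∈ Icc 0 T, f t = 0) (hS : Icc 0 T ⊆ S),
    IsWeakNSSolutionOn T ν u

/-- Energy balance for classical solutions: on the time set `S`, `t ↦ E(u(t))` has the one-sided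
derivative `−ν ‖∇u(t)‖₂² + ∫ ⟪f(t), u(t)⟫` (take the inner product of the momentum equation with
`u`, integrate over `T^d`; the convective and pressure terms vanish by incompressibility and
`Torus.integral_inner_laplacian_eq_neg`; Doering–Foias 2002, §2, eq. (2.4); Fefferman, §1). The
time set is assumed convex (an interval, e.g. `Icc 0 T`, `Ici 0`) so that differentiation under
the integral over the compact `T^d` within `S` is justified by joint smoothness and the mean
value inequality along time segments in `S`. [cite: DoeringFoias2002, §2  eq. (2.4] -/
def IsClassicalNSSolutionOn.energy_balance : Prop :=
  ∀ {S : Set ℝ} {ν : ℝ} {f u : ℝ → UnitAddTorus d → EuclideanSpace ℝ d} {p : ℝ → UnitAddTorus d → ℝ} (h : IsClassicalNSSolutionOn S ν f u p) (hS : Convex ℝ S) {t : ℝ} (ht : t ∈ S),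
    HasDerivWithinAt (fun s => kineticEnergy (u s))
      (-ν * gradNormSq (u t) + ∫ x, ⟪f t x, u t x⟫_ℝ) S t

end Weak

end Torus

end

end Literature.Analysis.FunctionSpaces
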